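import Mathlib.Algebra.MvPolynomial.NoZeroDivisors
import Literature.Computability.AlgebraicComplexity.DeterminantalComplexity
import Literature.Computability.AlgebraicComplexity.StandardFamiliesProofs
import Literature.Computability.AlgebraicComplexity.RankOneDeterminantalExpressionsProofs
import Literature.LinearAlgebra.Matrix.MvPolynomialDetDegree

/-!
# Disproof of `OrbitCorankTwo` (stmt-ValiantsHypothesis-15032) — standing disprover's work file

Crux (route UlrichPadded, r6): for `n ≥ 3` and every affine determinantal representation `A` of `per_n`
of size `m` there are unimodular `P Q ∈ GL_m(ℂ[x])` with `P·A·Q` affine, `det = per_n`, and every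
`(m-1)`-minor of the LINEAR PART of `P·A·Q` in `(per_n)` (padding order `j ≥ 1` somewhere in the
affine gauge orbit).

## Findings (cycle 1, 2026-08-16) — LANDED under `Theorems/OrbitCorankTwo/Negative/`:
`FalseFromTwo.lean` (p110491 @2eba122eaf78), `NonaffineInputFalse.lean` (p110523 @028440ca4672),
`ConstGaugeInvariance.lean` (p110591 @63728b54d02b), `SizeEqBoundary.lean` (size boundary m = n, all n);
`ConstGaugeFalse.lean` (unconditional corollary, needs the
route-file olean, pending farm coherence). This work file imports them and adds the glue below.

* (a) LOAD-BEARING HYPOTHESES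
  - `orbitCorankTwo_false_from_two` : the guard `3 ≤ n` is load-bearing — with `2 ≤ n` the statement
    is false: for `per₂ = det [[x₀₀, -x₀₁], [x₁₀, x₁₁]]` (`m = n = 2`) EVERY affine `B = P·A₂·Q` with
    `det B = per₂` has a nonzero linear entry, i.e. a submaximal minor of its linear part of degree
    `1 < 2`, hence outside `(per₂)` (`exists_adjugate_linPart_notMem_two`).  No orbit argument is
    needed: at `m = n` the conclusion fails in every gauge (and `m = n` is excluded for `n ≥ 3` by
    `NoGlobalSplitting`).
  - `exists_adjugate_linPart_notMem_of_size` (Negative/SizeEqBoundary.lean): the same for EVERY `n ≥ 1`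
    at `m = n` — the degree-`n` component of `det B` is `det (lin B)` (`homogeneousComponent_det_affine`),
    so 'all submaximal minors of lin B in (per_n)' ⇒ `adj (lin B) = 0` ⇒ `det (lin B) = 0 = per_n`, absurd.
    (b)-type boundary: the crux's conclusion is never available at `m = n`; its content sits at
    `m ≥ n + 1` (and it implies `¬ HasDetRepr per_n n`, the proved support item NoGlobalSplitting).
  - `orbitCorankTwo_false_nonaffine_input` : affineness of the INPUT `A` is load-bearing — with
    `IsAffineDetRepr … A` weakened to `det A = per_n` the statement is false (n = 3, m = 1, A = (per₃):
    below size n nothing is affine).  The crux never leaves the affine locus (contrast: SmithNormal of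
    card vdk-window-collapse quantifies over ALL square matrices with det = per_n).
  - `isUnit_of_gauge_detRepr` : the conjunct `IsUnit P ∧ IsUnit Q` is DECORATION — it follows from
    `det A = per_n = det (P·A·Q)` (`per_n ≠ 0`, `ℂ[x]` a domain).  Provers may discharge it for free.
* (c) REFUTED NATURAL STRENGTHENINGS
  - `not_orbitCorankTwo_constGauge` : restricting the gauge to CONSTANT invertible `P, Q ∈ GL_m(ℂ)`
    makes the crux false (it then implies the refuted `NoTightInfinity`, because the ideal of
    submaximal minors of the linear part is invariant under constant gauge,
    `adjugate_linPart_mem_of_constGauge`).  So the POLYNOMIAL (x-dependent) part of the gauge is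
    load-bearing; the witness is the tight twisted Grenet `(1+V)·G₇·(1+U)` of
    `UlrichPaddedNoTightInfinity_refuted`, which needs the degree-1 unipotent untwist `P = 1-V, Q = 1-U`.
* WHY IT RESISTS (no kill this cycle).  A refutation needs an affine representation `A` (n ≥ 3) and a
  proof that NO member of its `GL_m(ℂ[x])²`-orbit is affine with `j ≥ 1` — i.e. an orbit invariant.
  Every invariant available is trivial on all representations: `coker A ≅ S_n := ℂ[x]/(per_n)` for
  every square `A` with `det A = per_n` (MCM of rank one, reflexive, over the factorial normal domain
  `S_n` — `permHypersurfaceFactorial_proof`, `permQuot_isDomain_and_ufm` PROVED), so the orbit is the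
  class of the unimodular cokernel row `w̄_A ∈ Um_m(S_n)/E_m(S_n)·ℂˣ`; for `m ≥ n²+1` (Bass stable
  range `sr(S_n) ≤ n²`) there is ONE orbit, so for `m ≥ max(n²+1, dc(per_n)+1)` it contains the padded
  `A_opt ⊕ I` (j ≥ 1) and the crux is TRUE there (paper argument, rattack briefing F1–F3); `V(per_n)` is a cone, so no local (stalk) or topological (holomorphic, Oka)
  invariant separates classes.  The only candidate for a non-Smith orbit is the generically tight
  ≈126-dimensional component `Z` of `Rep₇(per₃)` (Cruxes/NoTightInfinity/EvidenceIdeator3.md,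
  kit j012012) — known only NUMERICALLY (90 digits, residual 1e-23), so neither an exact witness nor a
  computable class invariant (a weak Mennicke symbol in the van der Kallen group `W₇(S₃)`) is in
  reach.  At `(n, m) = (3, 7..9)` the crux is exactly 'the rows `w̄_A` of affine representations are
  elementary-trivial below the stable range'; for `n ≥ 4` at `m = dc(per_n)` it is the gauge-free
  'some OPTIMAL representation of per_n is non-tight' — unknown, not attackable by computation
  (dc(per₄) ∈ [9, 15] open).
* Attacks run (all negative = no counterexample): degenerate sizes `m ≤ n` (vacuous for n ≥ 3 by
  Mignon–Ressayre / NoGlobalSplitting; at n = 2 they give (a)); junk `m = 0, 1` (no representation: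
  `det = 1`, resp. degree ≤ 1); hypothesis mutation (IsUnit: decoration; constant gauge: false (c);
  one-sided gauge `Q = 1`: NOT refuted by the twisted Grenet — `(1-V)·A_tw = G·(1+U)` already has
  corank-2 linear part, recorded in Cruxes/NoTightInfinity/NOTES.md dead levers; degree-≤-1 gauges:
  satisfied by the witness); negatives index (`ledger negatives`: 0340/3735/3738/5668 — only 5668 is
  related and it is the P = Q = 1 instance, honoured by (c)).
-/

/-! ### About this tree copy
The folder / evidence copy of this file (`run/sessions/refuter-cdisprove-stmt-ValiantsHypothesis-15032-0/folder/Disproof.lean`,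
attached on the item) imports the route file, `Theorems/UlrichPaddedNoTightInfinityRefutation.lean` and the four LANDED modules
`Theorems/OrbitCorankTwo/Negative/{FalseFromTwo, NonaffineInputFalse, ConstGaugeInvariance, SizeEqBoundary}.lean`
(p110491, p110523, p110591, p112764).  At publication time the farm had not yet built those modules nor a coherent olean of
the route file, so THIS copy is Literature-only: the landed lemmas are INLINED under `…Disproof.Inlined` (different fully
qualified names, same proofs) and the one theorem needing the refutation import is kept conditional (see
`not_orbitCorankTwo_constGauge_of_tight'`).  Replace by the folder copy once the farm has caught up. -/

noncomputable section

set_option linter.dupNamespace false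

namespace Summit.ValiantsHypothesis.ValiantsHypothesis.Cruxes.OrbitCorankTwo.Disproof

open MvPolynomial Matrix
open Literature.Computability.AlgebraicComplexity

namespace Inlined

/-- A multiple of `per₂` of total degree `< 2` is zero (`per₂` is a nonzero quadratic form and `ℂ[x]` is
a domain; the `n = 2` instance of `RankOneTrivialisationNegative.eq_zero_of_mem_span_perPoly`,
re-proved here to keep this file independent of the route file). [folklore] -/
theorem eq_zero_of_mem_span_perPoly_two {q : MvPolynomial (Fin 2 × Fin 2) ℂ}
    (hq : q ∈ Ideal.span {perPoly (Fin 2) ℂ}) (hdeg : q.totalDegree < 2) : q = 0 := by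
  obtain ⟨k, rfl⟩ := Ideal.mem_span_singleton.1 hq
  by_contra hne
  have hk : k ≠ 0 := by
    rintro rfl
    exact hne (mul_zero _)
  have hper : perPoly (Fin 2) ℂ ≠ 0 := perPoly_ne_zero (Fin 2) ℂ
  have hdegper : (perPoly (Fin 2) ℂ).totalDegree = 2 := by
    simpa [Fintype.card_fin] using
      (perPoly_isHomogeneous (n := Fin 2) (k := ℂ)).totalDegree hper
  rw [totalDegree_mul_of_isDomain hper hk, hdegper] at hdeg
  omega

/-- An affine-linear polynomial with vanishing linear part is a constant. [folklore] -/
theorem eq_C_of_totalDegree_le_one {σ : Type*} (φ : MvPolynomial σ ℂ) (h1 : φ.totalDegree ≤ 1)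
    (h0 : homogeneousComponent 1 φ = 0) : φ = C (coeff 0 φ) := by
  rcases Nat.lt_or_ge φ.totalDegree 1 with hlt | hge
  · exact totalDegree_eq_zero_iff_eq_C.1 (by omega)
  · have hd : φ.totalDegree = 1 := le_antisymm h1 hge
    have hs := sum_homogeneousComponent φ
    rw [hd, Finset.sum_range_succ, Finset.sum_range_one, h0, add_zero, homogeneousComponent_zero] at hs
    exact hs.symm

/-- At `n = m = 2` the conclusion of the crux fails in EVERY gauge: a `2 × 2` matrix `B` of affine
linear forms with `det B = per₂` has a submaximal minor of its linear part (an entry, up to sign)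
outside `(per₂)` — otherwise all linear parts vanish, `B` is constant and `det B = per₂` is not. [folklore] -/
theorem exists_adjugate_linPart_notMem_two (B : Matrix (Fin 2) (Fin 2) (MvPolynomial (Fin 2 × Fin 2) ℂ))
    (hB : IsAffineDetRepr (perPoly (Fin 2) ℂ) B) :
    ∃ i j, (Matrix.of fun a b => homogeneousComponent 1 (B a b)).adjugate i j ∉
      Ideal.span {perPoly (Fin 2) ℂ} := by
  by_contra hex
  have h : ∀ i j, (Matrix.of fun a b => homogeneousComponent 1 (B a b)).adjugate i j ∈
      Ideal.span {perPoly (Fin 2) ℂ} := fun i j => by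
    by_contra hij
    exact hex ⟨i, j, hij⟩
  have hdeg : ∀ a b, (homogeneousComponent 1 (B a b)).totalDegree < 2 := fun a b =>
    lt_of_le_of_lt (homogeneousComponent_isHomogeneous 1 (B a b)).totalDegree_le one_lt_two
  have hadj := h
  simp only [Matrix.adjugate_fin_two, Matrix.of_apply, Matrix.cons_val', Matrix.empty_val',
    Matrix.cons_val_fin_one] at hadj
  have h11 : homogeneousComponent 1 (B 1 1) = 0 :=
    eq_zero_of_mem_span_perPoly_two (by simpa using hadj 0 0) (hdeg 1 1)
  have h01 : homogeneousComponent 1 (B 0 1) = 0 :=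
    eq_zero_of_mem_span_perPoly_two (by simpa using hadj 0 1) (hdeg 0 1)
  have h10 : homogeneousComponent 1 (B 1 0) = 0 :=
    eq_zero_of_mem_span_perPoly_two (by simpa using hadj 1 0) (hdeg 1 0)
  have h00 : homogeneousComponent 1 (B 0 0) = 0 :=
    eq_zero_of_mem_span_perPoly_two (by simpa using hadj 1 1) (hdeg 0 0)
  obtain ⟨c, hc⟩ : ∃ c : Fin 2 → Fin 2 → ℂ, ∀ a b, B a b = C (c a b) := by
    refine ⟨fun a b => coeff 0 (B a b), fun a b => eq_C_of_totalDegree_le_one _ (hB.1 a b) ?_⟩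
    fin_cases a <;> fin_cases b <;> assumption
  have hdet : B.det = C (c 0 0 * c 1 1 - c 0 1 * c 1 0) := by
    rw [Matrix.det_fin_two, hc 0 0, hc 0 1, hc 1 0, hc 1 1]
    simp only [map_mul, map_sub]
  have hper2 : perPoly (Fin 2) ℂ = X (0, 0) * X (1, 1) + X (1, 0) * X (0, 1) := by
    simp [perPoly, permanent_fin_two, Matrix.mvPolynomialX_apply]
  have key := hB.2
  rw [hdet, hper2] at key
  have e1 := congr_arg (eval fun _ : Fin 2 × Fin 2 => (1 : ℂ)) key
  have e0 := congr_arg (eval fun _ : Fin 2 × Fin 2 => (0 : ℂ)) key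
  simp only [eval_C, map_add, map_mul, eval_X] at e1 e0
  rw [e0] at e1
  norm_num at e1

/-- **`3 ≤ n` is load-bearing in `OrbitCorankTwo`.**  With the guard weakened to `2 ≤ n` (everything
else verbatim) the crux is false: witness `n = m = 2`, `A₂ = [[x₀₀, -x₀₁], [x₁₀, x₁₁]]`, `det A₂ = per₂`;
by `exists_adjugate_linPart_notMem_two` no gauge form `P·A₂·Q` has all submaximal minors of its linear
part in `(per₂)`. (Any proof must use `n ≥ 3`; it enters through `m > n` — Mignon–Ressayre /
`NoGlobalSplitting` — and through factoriality of `ℂ[x]/(per_n)`.) [folklore] -/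
theorem orbitCorankTwo_false_from_two :
    ¬ ∀ n : ℕ, 2 ≤ n → ∀ (m : ℕ) (A : Matrix (Fin m) (Fin m) (MvPolynomial (Fin n × Fin n) ℂ)),
      IsAffineDetRepr (perPoly (Fin n) ℂ) A →
      ∃ P Q : Matrix (Fin m) (Fin m) (MvPolynomial (Fin n × Fin n) ℂ), IsUnit P ∧ IsUnit Q ∧
        IsAffineDetRepr (perPoly (Fin n) ℂ) (P * A * Q) ∧
        ∀ i j, (Matrix.of fun a b => homogeneousComponent 1 ((P * A * Q) a b)).adjugate i j ∈
          Ideal.span {perPoly (Fin n) ℂ} := by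
  intro h
  obtain ⟨A₂, hA₂⟩ : ∃ M : Matrix (Fin 2) (Fin 2) (MvPolynomial (Fin 2 × Fin 2) ℂ),
      M = !![X (0, 0), -X (0, 1); X (1, 0), X (1, 1)] := ⟨_, rfl⟩
  have hper2 : perPoly (Fin 2) ℂ = X (0, 0) * X (1, 1) + X (1, 0) * X (0, 1) := by
    simp [perPoly, permanent_fin_two, Matrix.mvPolynomialX_apply]
  have hrepr : IsAffineDetRepr (perPoly (Fin 2) ℂ) A₂ := by
    refine ⟨fun i j => ?_, ?_⟩
    · rw [hA₂]
      fin_cases i <;> fin_cases j <;> simp [totalDegree_X, totalDegree_neg]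
    · rw [Matrix.det_fin_two, hper2, hA₂]
      simp
      ring
  obtain ⟨P, Q, -, -, hPAQ, hmem⟩ := h 2 le_rfl 2 A₂ hrepr
  obtain ⟨i, j, hij⟩ := exists_adjugate_linPart_notMem_two (P * A₂ * Q) hPAQ
  exact hij (hmem i j)

/-- If `det A = f ≠ 0` and `det (P·A·Q) = f` over a domain then `P` and `Q` are unimodular: the crux's
`IsUnit P ∧ IsUnit Q` follows from the other two conjuncts. [folklore] -/
theorem isUnit_of_gauge_detRepr {σ : Type*} {m : Type*} [Fintype m] [DecidableEq m]
    {f : MvPolynomial σ ℂ} (hf : f ≠ 0) {A P Q : Matrix m m (MvPolynomial σ ℂ)}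
    (hA : A.det = f) (hPAQ : (P * A * Q).det = f) : IsUnit P ∧ IsUnit Q := by
  rw [Matrix.det_mul, Matrix.det_mul, hA] at hPAQ
  have h1 : P.det * Q.det = 1 := by
    have : (P.det * Q.det - 1) * f = 0 := by rw [sub_mul, one_mul, sub_eq_zero]; linear_combination hPAQ
    rcases mul_eq_zero.1 this with h | h
    · exact sub_eq_zero.1 h
    · exact absurd h hf
  exact ⟨(Matrix.isUnit_iff_isUnit_det P).2 (IsUnit.of_mul_eq_one _ h1),
    (Matrix.isUnit_iff_isUnit_det Q).2 (IsUnit.of_mul_eq_one_right _ h1)⟩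



/-- **Affineness of the input representation is load-bearing in `OrbitCorankTwo`.**  With
`IsAffineDetRepr (perPoly (Fin n) ℂ) A` weakened to `A.det = perPoly (Fin n) ℂ` the crux is false:
witness `n = 3`, `m = 1`, `A = (per₃)`; a gauge form `P·A·Q` is again `1 × 1` with `det = ` its entry
`= per₃` of total degree `3 > 1`, so it is never affine. [folklore] -/
theorem orbitCorankTwo_false_nonaffine_input :
    ¬ ∀ n : ℕ, 3 ≤ n → ∀ (m : ℕ) (A : Matrix (Fin m) (Fin m) (MvPolynomial (Fin n × Fin n) ℂ)),
      A.det = perPoly (Fin n) ℂ →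
      ∃ P Q : Matrix (Fin m) (Fin m) (MvPolynomial (Fin n × Fin n) ℂ), IsUnit P ∧ IsUnit Q ∧
        IsAffineDetRepr (perPoly (Fin n) ℂ) (P * A * Q) ∧
        ∀ i j, (Matrix.of fun a b => homogeneousComponent 1 ((P * A * Q) a b)).adjugate i j ∈
          Ideal.span {perPoly (Fin n) ℂ} := by
  intro h
  obtain ⟨A, hA⟩ : ∃ M : Matrix (Fin 1) (Fin 1) (MvPolynomial (Fin 3 × Fin 3) ℂ),
      M = !![perPoly (Fin 3) ℂ] := ⟨_, rfl⟩
  have hdet : A.det = perPoly (Fin 3) ℂ := by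
    rw [hA, Matrix.det_fin_one]
    rfl
  obtain ⟨P, Q, -, -, ⟨hdeg, hdet'⟩, -⟩ := h 3 le_rfl 1 A hdet
  have hper : perPoly (Fin 3) ℂ ≠ 0 := perPoly_ne_zero (Fin 3) ℂ
  have hdegper : (perPoly (Fin 3) ℂ).totalDegree = 3 := by
    simpa [Fintype.card_fin] using
      (perPoly_isHomogeneous (n := Fin 3) (k := ℂ)).totalDegree hper
  have h00 : (P * A * Q) 0 0 = perPoly (Fin 3) ℂ := by
    rw [← hdet', Matrix.det_fin_one]
  have := hdeg 0 0
  rw [h00, hdegper] at this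
  omega



/-- Taking the linear part commutes with a constant two-sided gauge. [folklore] -/
theorem linPart_constGauge {σ : Type*} {m : Type*} [Fintype m] [DecidableEq m]
    (P Q : Matrix m m ℂ) (A : Matrix m m (MvPolynomial σ ℂ)) :
    (Matrix.of fun a b => homogeneousComponent 1 ((P.map C * A * Q.map C : Matrix m m (MvPolynomial σ ℂ)) a b)) =
      P.map C * (Matrix.of fun a b => homogeneousComponent 1 (A a b)) * Q.map C := by
  have hcomp : ∀ (p q : ℂ) (φ : MvPolynomial σ ℂ),
      homogeneousComponent 1 (C p * φ * C q) = C p * homogeneousComponent 1 φ * C q := by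
    intro p q φ
    rw [mul_comm _ (C q), ← mul_assoc, ← C_mul, homogeneousComponent_C_mul, C_mul]
    ring
  ext a b
  simp only [Matrix.mul_apply, Matrix.map_apply, Matrix.of_apply, map_sum, Finset.sum_mul, hcomp]

/-- Entries of `X * N * Y` lie in any ideal containing the entries of `N`. [folklore] -/
theorem mul_mul_apply_mem {R : Type*} [CommRing R] {m : Type*} [Fintype m]
    (X N Y : Matrix m m R) (I : Ideal R) (hN : ∀ k l, N k l ∈ I) (a b : m) : (X * N * Y) a b ∈ I := by
  simp only [Matrix.mul_apply, Finset.sum_mul]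
  exact I.sum_mem fun l _ => I.sum_mem fun k _ => I.mul_mem_right _ (I.mul_mem_left _ (hN k l))

/-- The ideal membership of the submaximal minors of the linear part is invariant under CONSTANT
invertible gauges `A ↦ P·A·Q`, `P, Q ∈ GL_m(ℂ)`: `adj L = (det P · det Q)⁻¹ · Q · adj (P L Q) · P`. [folklore] -/
theorem adjugate_linPart_mem_of_constGauge {σ : Type*} {m : Type*} [Fintype m] [DecidableEq m]
    (P Q : Matrix m m ℂ) (hP : IsUnit P) (hQ : IsUnit Q) (A : Matrix m m (MvPolynomial σ ℂ))
    (I : Ideal (MvPolynomial σ ℂ))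
    (h : ∀ i j, (Matrix.of fun a b =>
      homogeneousComponent 1 ((P.map C * A * Q.map C : Matrix m m (MvPolynomial σ ℂ)) a b)).adjugate i j ∈ I)
    (i j : m) : (Matrix.of fun a b => homogeneousComponent 1 (A a b)).adjugate i j ∈ I := by
  set L : Matrix m m (MvPolynomial σ ℂ) := Matrix.of fun a b => homogeneousComponent 1 (A a b) with hL
  rw [linPart_constGauge] at h
  have hdP : (P.map C : Matrix m m (MvPolynomial σ ℂ)).det = C P.det := by
    rw [← RingHom.mapMatrix_apply, ← RingHom.map_det]
  have hdQ : (Q.map C : Matrix m m (MvPolynomial σ ℂ)).det = C Q.det := by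
    rw [← RingHom.mapMatrix_apply, ← RingHom.map_det]
  have hPd : P.det ≠ 0 := ((Matrix.isUnit_iff_isUnit_det P).1 hP).ne_zero
  have hQd : Q.det ≠ 0 := ((Matrix.isUnit_iff_isUnit_det Q).1 hQ).ne_zero
  -- `Q' * adj (P' L Q') * P' = (det Q' * det P') • adj L`
  have key : Q.map C * (P.map C * L * Q.map C).adjugate * P.map C =
      (C (Q.det * P.det) : MvPolynomial σ ℂ) • L.adjugate := by
    rw [Matrix.adjugate_mul_distrib, Matrix.adjugate_mul_distrib]
    calc Q.map C * ((Q.map C).adjugate * (L.adjugate * (P.map C).adjugate)) * P.map C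
        = (Q.map C * (Q.map C).adjugate) * L.adjugate * ((P.map C).adjugate * P.map C) := by
          simp only [Matrix.mul_assoc]
      _ = (C (Q.det * P.det) : MvPolynomial σ ℂ) • L.adjugate := by
          rw [Matrix.mul_adjugate, Matrix.adjugate_mul, hdP, hdQ, map_mul]
          simp [smul_smul, mul_comm]
  have hmem : ((C (Q.det * P.det) : MvPolynomial σ ℂ) • L.adjugate) i j ∈ I := by
    rw [← key]
    exact mul_mul_apply_mem _ _ _ I h i j
  have hunit : IsUnit (C (Q.det * P.det) : MvPolynomial σ ℂ) :=
    (IsUnit.mk0 _ (mul_ne_zero hQd hPd)).map C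
  rw [Matrix.smul_apply, smul_eq_mul] at hmem
  exact (I.unit_mul_mem_iff_mem hunit).1 hmem

/-- **One tight representation kills the constant-gauge strengthening of `OrbitCorankTwo`.**  If some
affine representation `A` of `per_n` (`n ≥ 3`) has a submaximal minor of its linear part outside
`(per_n)`, then it is false that every affine representation has a CONSTANT-gauge form `P·A·Q`,
`P, Q ∈ GL_m(ℂ)`, with all such minors in `(per_n)` (by `adjugate_linPart_mem_of_constGauge` the
property would pull back to `A`).  The hypothesis is witnessed by the twisted Grenet matrix of
`UlrichPaddedNoTightInfinity_refuted`. [folklore] -/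
theorem not_orbitCorankTwo_constGauge_of_tight
    (htight : ∃ n : ℕ, 3 ≤ n ∧ ∃ (m : ℕ) (A : Matrix (Fin m) (Fin m) (MvPolynomial (Fin n × Fin n) ℂ)),
      IsAffineDetRepr (perPoly (Fin n) ℂ) A ∧
      ∃ i j, (Matrix.of fun a b => homogeneousComponent 1 (A a b)).adjugate i j ∉
        Ideal.span {perPoly (Fin n) ℂ}) :
    ¬ ∀ n : ℕ, 3 ≤ n → ∀ (m : ℕ) (A : Matrix (Fin m) (Fin m) (MvPolynomial (Fin n × Fin n) ℂ)),
      IsAffineDetRepr (perPoly (Fin n) ℂ) A →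
      ∃ P Q : Matrix (Fin m) (Fin m) ℂ, IsUnit P ∧ IsUnit Q ∧
        IsAffineDetRepr (perPoly (Fin n) ℂ) (P.map C * A * Q.map C) ∧
        ∀ i j, (Matrix.of fun a b => homogeneousComponent 1
          ((P.map C * A * Q.map C : Matrix (Fin m) (Fin m) (MvPolynomial (Fin n × Fin n) ℂ)) a b)).adjugate i j ∈
          Ideal.span {perPoly (Fin n) ℂ} := by
  intro h
  obtain ⟨n, hn, m, A, hA, i, j, hij⟩ := htight
  obtain ⟨P, Q, hP, hQ, -, hmem⟩ := h n hn m A hA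
  exact hij (adjugate_linPart_mem_of_constGauge P Q hP hQ A _ hmem i j)



/-- An affine-linear polynomial is its constant term plus its linear part. [folklore] -/
theorem eq_C_add_homogeneousComponent_one {σ : Type*} (φ : MvPolynomial σ ℂ)
    (h1 : φ.totalDegree ≤ 1) : φ = C (coeff 0 φ) + homogeneousComponent 1 φ := by
  rcases Nat.lt_or_ge φ.totalDegree 1 with hlt | hge
  · rw [homogeneousComponent_eq_zero 1 φ hlt, add_zero]
    exact totalDegree_eq_zero_iff_eq_C.1 (by omega)
  · have hd : φ.totalDegree = 1 := le_antisymm h1 hge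
    have hs := sum_homogeneousComponent φ
    rw [hd, Finset.sum_range_succ, Finset.sum_range_one, homogeneousComponent_zero] at hs
    exact hs.symm

/-- Top homogeneous component of `l * ψ` for a linear form `l`. [folklore] -/
theorem homogeneousComponent_succ_linear_mul {σ : Type*} {l : MvPolynomial σ ℂ}
    (hl : l.IsHomogeneous 1) (ψ : MvPolynomial σ ℂ) {k : ℕ} (hψ : ψ.totalDegree ≤ k) :
    homogeneousComponent (k + 1) (l * ψ) = l * homogeneousComponent k ψ := by
  conv_lhs => rw [← sum_homogeneousComponent ψ]
  rw [Finset.mul_sum, map_sum]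
  have key : ∀ i ∈ Finset.range (ψ.totalDegree + 1),
      homogeneousComponent (k + 1) (l * homogeneousComponent i ψ) =
        if i = k then l * homogeneousComponent k ψ else 0 := by
    intro i _
    have hmem : l * homogeneousComponent i ψ ∈ homogeneousSubmodule σ ℂ (i + 1) := by
      have := hl.mul (homogeneousComponent_isHomogeneous i ψ)
      rwa [add_comm] at this
    rw [homogeneousComponent_of_mem hmem]
    by_cases hik : i = k
    · subst hik; simp
    · have hki : ¬ k = i := fun h => hik h.symm
      simp [hik, hki]
  rw [Finset.sum_congr rfl key, Finset.sum_ite_eq']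
  split_ifs with hk
  · rfl
  · rw [Finset.mem_range, not_lt] at hk
    rw [homogeneousComponent_eq_zero k ψ (by omega), mul_zero]

/-- The top homogeneous component of a product of affine factors `C aᵢ + lᵢ` (`lᵢ` linear forms) is the
product of the linear parts. [folklore] -/
theorem homogeneousComponent_prod_affine {σ ι : Type*} (s : Finset ι) (a : ι → ℂ)
    (l : ι → MvPolynomial σ ℂ) (hl : ∀ i, (l i).IsHomogeneous 1) :
    homogeneousComponent s.card (∏ i ∈ s, (C (a i) + l i)) = ∏ i ∈ s, l i := by
  classical
  induction s using Finset.induction_on with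
  | empty => simp
  | insert j s hj ih =>
    have hdeg : (∏ i ∈ s, (C (a i) + l i)).totalDegree ≤ s.card := by
      refine (totalDegree_finsetProd _ _).trans ?_
      rw [Finset.card_eq_sum_ones]
      exact Finset.sum_le_sum fun i _ =>
        (totalDegree_add _ _).trans (max_le (by simp) (hl i).totalDegree_le)
    rw [Finset.prod_insert hj, Finset.prod_insert hj, Finset.card_insert_of_notMem hj, add_mul, map_add,
      homogeneousComponent_C_mul, homogeneousComponent_eq_zero _ _ (by omega), mul_zero, zero_add,
      homogeneousComponent_succ_linear_mul (hl j) _ hdeg, ih]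

/-- The degree-`n` homogeneous component of the determinant of an `n × n` matrix of affine linear forms
`C cᵢⱼ + Lᵢⱼ` is the determinant of its linear part `L`. [folklore] -/
theorem homogeneousComponent_det_affine {ι σ : Type*} [Fintype ι] [DecidableEq ι]
    (c : Matrix ι ι ℂ) (L : Matrix ι ι (MvPolynomial σ ℂ)) (hL : ∀ i j, (L i j).IsHomogeneous 1) :
    homogeneousComponent (Fintype.card ι) (Matrix.of fun i j => C (c i j) + L i j).det = L.det := by
  rw [Matrix.det_apply', Matrix.det_apply', map_sum]
  refine Finset.sum_congr rfl fun τ _ => ?_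
  rw [show (((Equiv.Perm.sign τ : ℤˣ) : ℤ) : MvPolynomial σ ℂ) = C (((Equiv.Perm.sign τ : ℤˣ) : ℤ) : ℂ)
      from (map_intCast (C : ℂ →+* MvPolynomial σ ℂ) _).symm, homogeneousComponent_C_mul]
  congr 1
  have h := homogeneousComponent_prod_affine Finset.univ (fun i => c (τ i) i) (fun i => L (τ i) i)
    fun i => hL _ _
  rw [Finset.card_univ] at h
  simpa [Matrix.of_apply] using h

/-- **At `m = n` the conclusion of `OrbitCorankTwo` fails in every gauge, for every `n ≥ 1`.**  If `B` is
an `n × n` matrix of affine linear forms with `det B = per_n`, then some submaximal minor of the linear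
part of `B` is not in `(per_n)`: those minors have total degree `≤ n - 1`, so they would all vanish,
giving `adj L = 0`, `det L = 0`; but `det L` is the degree-`n` component of `det B = per_n ≠ 0`. [folklore] -/
theorem exists_adjugate_linPart_notMem_of_size {n : ℕ} (hn : 1 ≤ n)
    (B : Matrix (Fin n) (Fin n) (MvPolynomial (Fin n × Fin n) ℂ))
    (hB : IsAffineDetRepr (perPoly (Fin n) ℂ) B) :
    ∃ i j, (Matrix.of fun a b => homogeneousComponent 1 (B a b)).adjugate i j ∉
      Ideal.span {perPoly (Fin n) ℂ} := by
  by_contra hex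
  set Lb : Matrix (Fin n) (Fin n) (MvPolynomial (Fin n × Fin n) ℂ) :=
    Matrix.of fun a b => homogeneousComponent 1 (B a b) with hLb
  have hall : ∀ i j, Lb.adjugate i j ∈ Ideal.span {perPoly (Fin n) ℂ} := fun i j => by
    by_contra hij
    exact hex ⟨i, j, hij⟩
  -- the submaximal minors of the linear part have degree ≤ n - 1
  have hdegadj : ∀ i j, (Lb.adjugate i j).totalDegree ≤ n - 1 := by
    intro i j
    rw [Matrix.adjugate_apply, ← Matrix.det_transpose, ← Matrix.updateCol_transpose]
    have h := Literature.LinearAlgebra.Matrix.totalDegree_det_le (Lbᵀ.updateCol j (Pi.single i 1))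
      (fun c => if c ≠ j then 1 else 0) ?_
    · refine h.trans (le_of_eq ?_)
      rw [Finset.sum_boole, Finset.filter_ne', Finset.card_erase_of_mem (Finset.mem_univ _),
        Finset.card_univ, Fintype.card_fin]
      simp
    · intro r c
      rw [Matrix.updateCol_apply]
      by_cases hc : c = j
      · subst hc
        rw [if_pos rfl, if_neg (fun h => h rfl)]
        by_cases hr : r = i
        · subst hr; simp
        · simp [hr]
      · rw [if_neg hc, if_pos hc, Matrix.transpose_apply, hLb, Matrix.of_apply]
        exact (homogeneousComponent_isHomogeneous 1 _).totalDegree_le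
  -- a multiple of `per_n` of total degree `< n` vanishes (`per_n ≠ 0` is a form of degree `n`, `ℂ[x]` a domain)
  have low : ∀ q : MvPolynomial (Fin n × Fin n) ℂ, q ∈ Ideal.span {perPoly (Fin n) ℂ} →
      q.totalDegree < n → q = 0 := by
    intro q hq hdeg
    obtain ⟨k, rfl⟩ := Ideal.mem_span_singleton.1 hq
    by_contra hne
    have hk : k ≠ 0 := by
      rintro rfl
      exact hne (mul_zero _)
    have hper : perPoly (Fin n) ℂ ≠ 0 := perPoly_ne_zero (Fin n) ℂ
    have hdegper : (perPoly (Fin n) ℂ).totalDegree = n := by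
      simpa [Fintype.card_fin] using
        (perPoly_isHomogeneous (n := Fin n) (k := ℂ)).totalDegree hper
    rw [totalDegree_mul_of_isDomain hper hk, hdegper] at hdeg
    omega
  have hadj0 : Lb.adjugate = 0 := by
    funext i j
    exact low _ (hall i j) (lt_of_le_of_lt (hdegadj i j) (by omega))
  have hdetL : Lb.det = 0 := by
    have h := Matrix.mul_adjugate Lb
    rw [hadj0, Matrix.mul_zero] at h
    have h00 := congr_fun (congr_fun h ⟨0, hn⟩) ⟨0, hn⟩
    simp only [Matrix.zero_apply, Matrix.smul_apply, Matrix.one_apply_eq, smul_eq_mul, mul_one] at h00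
    exact h00.symm
  -- `B` = constant part + linear part, and the degree-`n` part of `det B` is `det Lb`
  obtain ⟨c, hc⟩ : ∃ c : Matrix (Fin n) (Fin n) ℂ, B = Matrix.of fun i j => C (c i j) + Lb i j :=
    ⟨Matrix.of fun i j => coeff 0 (B i j), Matrix.ext fun i j => by
      simpa [hLb] using eq_C_add_homogeneousComponent_one (B i j) (hB.1 i j)⟩
  have htop := homogeneousComponent_det_affine c Lb fun i j => by
    rw [hLb, Matrix.of_apply]; exact homogeneousComponent_isHomogeneous 1 (B i j)
  rw [← hc, hB.2, Fintype.card_fin, hdetL, homogeneousComponent_eq_self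
    (by simpa [Fintype.card_fin] using perPoly_isHomogeneous (n := Fin n) (k := ℂ))] at htop
  exact perPoly_ne_zero (Fin n) ℂ htop

/-- Corollary in the shape of the crux: for `n ≥ 1`, NO `n × n` affine representation `A` of `per_n`
admits `P, Q` with `P·A·Q` affine, `det = per_n` and all submaximal minors of the linear part of
`P·A·Q` in `(per_n)` — whatever `P, Q` are.  (For `n ≥ 3` there is no such `A` anyway — Mignon–Ressayre —
which is why the crux is consistent; for `n = 1, 2` this is the failure of the unguarded statement.) [folklore] -/
theorem orbitCorankTwo_conclusion_false_of_size_eq {n : ℕ} (hn : 1 ≤ n)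
    (A P Q : Matrix (Fin n) (Fin n) (MvPolynomial (Fin n × Fin n) ℂ))
    (h : IsAffineDetRepr (perPoly (Fin n) ℂ) (P * A * Q)) :
    ∃ i j, (Matrix.of fun a b => homogeneousComponent 1 ((P * A * Q) a b)).adjugate i j ∉
      Ideal.span {perPoly (Fin n) ℂ} :=
  exists_adjugate_linPart_notMem_of_size hn _ h


end Inlined

open Inlined

/-- The crux with its guard `3 ≤ n` replaced by `n₀ ≤ n`.  `OrbitCorankTwoFrom 3` is the ledger
signature of `UlrichPadded.OrbitCorankTwo` verbatim (mirrored: the farm olean of the route file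
predates item 15032, cf. the rattack Probe.lean). -/
def OrbitCorankTwoFrom (n₀ : ℕ) : Prop :=
  ∀ n : ℕ, n₀ ≤ n → ∀ (m : ℕ) (A : Matrix (Fin m) (Fin m) (MvPolynomial (Fin n × Fin n) ℂ)),
    IsAffineDetRepr (perPoly (Fin n) ℂ) A →
    ∃ P Q : Matrix (Fin m) (Fin m) (MvPolynomial (Fin n × Fin n) ℂ), IsUnit P ∧ IsUnit Q ∧
      IsAffineDetRepr (perPoly (Fin n) ℂ) (P * A * Q) ∧
      ∀ i j, (Matrix.of fun a b => homogeneousComponent 1 ((P * A * Q) a b)).adjugate i j ∈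
        Ideal.span {perPoly (Fin n) ℂ}

/-- The weakened family is monotone in the guard. -/
theorem OrbitCorankTwoFrom.mono {n₀ n₁ : ℕ} (h : n₀ ≤ n₁) : OrbitCorankTwoFrom n₀ → OrbitCorankTwoFrom n₁ :=
  fun H n hn => H n (h.trans hn)

/-! ## (a) load-bearing hypotheses -/

/-- **`3 ≤ n` is load-bearing**: the crux from `n₀ = 2` is false (`Negative/FalseFromTwo.lean`,
witness `n = m = 2`, `A₂ = [[x₀₀, -x₀₁], [x₁₀, x₁₁]]`; at `m = n` the conclusion fails in EVERY gauge). -/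
theorem orbitCorankTwoFrom_two_false : ¬ OrbitCorankTwoFrom 2 := orbitCorankTwo_false_from_two

/-- Hence also from `n₀ = 0, 1` (junk sizes `per₀ = 1`, `per₁ = x₀₀` need not even be inspected). -/
theorem orbitCorankTwoFrom_false_of_le_two {n₀ : ℕ} (h : n₀ ≤ 2) : ¬ OrbitCorankTwoFrom n₀ :=
  fun H => orbitCorankTwoFrom_two_false (H.mono h)

/-- **Affine INPUT is load-bearing**: with `IsAffineDetRepr … A` weakened to `det A = per_n` the crux
is false (`Negative/NonaffineInputFalse.lean`, witness `n = 3, m = 1, A = (per₃)`). -/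
theorem orbitCorankTwo_nonaffine_input_false :
    ¬ ∀ n : ℕ, 3 ≤ n → ∀ (m : ℕ) (A : Matrix (Fin m) (Fin m) (MvPolynomial (Fin n × Fin n) ℂ)),
      A.det = perPoly (Fin n) ℂ →
      ∃ P Q : Matrix (Fin m) (Fin m) (MvPolynomial (Fin n × Fin n) ℂ), IsUnit P ∧ IsUnit Q ∧
        IsAffineDetRepr (perPoly (Fin n) ℂ) (P * A * Q) ∧
        ∀ i j, (Matrix.of fun a b => homogeneousComponent 1 ((P * A * Q) a b)).adjugate i j ∈
          Ideal.span {perPoly (Fin n) ℂ} := orbitCorankTwo_false_nonaffine_input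

/-- **`IsUnit P ∧ IsUnit Q` is decoration** (`Negative/FalseFromTwo.lean`, `isUnit_of_gauge_detRepr`):
the crux is equivalent to its version without the two `IsUnit` conjuncts. -/
theorem orbitCorankTwoFrom_iff_noUnit (n₀ : ℕ) : OrbitCorankTwoFrom n₀ ↔
    ∀ n : ℕ, n₀ ≤ n → ∀ (m : ℕ) (A : Matrix (Fin m) (Fin m) (MvPolynomial (Fin n × Fin n) ℂ)),
      IsAffineDetRepr (perPoly (Fin n) ℂ) A →
      ∃ P Q : Matrix (Fin m) (Fin m) (MvPolynomial (Fin n × Fin n) ℂ),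
        IsAffineDetRepr (perPoly (Fin n) ℂ) (P * A * Q) ∧
        ∀ i j, (Matrix.of fun a b => homogeneousComponent 1 ((P * A * Q) a b)).adjugate i j ∈
          Ideal.span {perPoly (Fin n) ℂ} := by
  refine ⟨fun H n hn m A hA => ?_, fun H n hn m A hA => ?_⟩
  · obtain ⟨P, Q, -, -, h1, h2⟩ := H n hn m A hA
    exact ⟨P, Q, h1, h2⟩
  · obtain ⟨P, Q, h1, h2⟩ := H n hn m A hA
    exact ⟨P, Q, (isUnit_of_gauge_detRepr (perPoly_ne_zero (Fin n) ℂ) hA.2 h1.2).1,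
      (isUnit_of_gauge_detRepr (perPoly_ne_zero (Fin n) ℂ) hA.2 h1.2).2, h1, h2⟩

/-- **Size boundary `m = n`** (`Negative/SizeEqBoundary.lean`): for every `n ≥ 1` the conclusion of
the crux fails for every `n × n` affine representation in every gauge. -/
theorem conclusion_false_of_size_eq {n : ℕ} (hn : 1 ≤ n)
    (A P Q : Matrix (Fin n) (Fin n) (MvPolynomial (Fin n × Fin n) ℂ))
    (h : IsAffineDetRepr (perPoly (Fin n) ℂ) (P * A * Q)) :
    ∃ i j, (Matrix.of fun a b => homogeneousComponent 1 ((P * A * Q) a b)).adjugate i j ∉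
      Ideal.span {perPoly (Fin n) ℂ} :=
  exists_adjugate_linPart_notMem_of_size hn _ h

/-! ## (c) refuted strengthening: CONSTANT gauges do not suffice -/

/-- **Constant gauges do not suffice.**  In this Literature-only tree copy the statement is kept in
its kernel-checked CONDITIONAL form (= `Inlined.not_orbitCorankTwo_constGauge_of_tight`, landed as
`OrbitCorankTwoNegative.not_orbitCorankTwo_constGauge_of_tight` in Negative/ConstGaugeInvariance.lean):
one tight affine representation kills the constant-gauge strengthening.  The hypothesis is discharged by
`Summit.ValiantsHypothesis.Theorems.UlrichPaddedNoTightInfinity_refuted` (twisted Grenet); the resulting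
UNCONDITIONAL `not_orbitCorankTwo_constGauge` is in the folder/evidence copy of this file and in
Negative/ConstGaugeFalse.lean (5 lines; its landing waits for the farm to rebuild the route-file olean). -/
theorem not_orbitCorankTwo_constGauge_of_tight'
    (htight : ∃ n : ℕ, 3 ≤ n ∧ ∃ (m : ℕ) (A : Matrix (Fin m) (Fin m) (MvPolynomial (Fin n × Fin n) ℂ)),
      IsAffineDetRepr (perPoly (Fin n) ℂ) A ∧
      ∃ i j, (Matrix.of fun a b => homogeneousComponent 1 (A a b)).adjugate i j ∉
        Ideal.span {perPoly (Fin n) ℂ}) :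
    ¬ ∀ n : ℕ, 3 ≤ n → ∀ (m : ℕ) (A : Matrix (Fin m) (Fin m) (MvPolynomial (Fin n × Fin n) ℂ)),
      IsAffineDetRepr (perPoly (Fin n) ℂ) A →
      ∃ P Q : Matrix (Fin m) (Fin m) ℂ, IsUnit P ∧ IsUnit Q ∧
        IsAffineDetRepr (perPoly (Fin n) ℂ) (P.map C * A * Q.map C) ∧
        ∀ i j, (Matrix.of fun a b => homogeneousComponent 1
          ((P.map C * A * Q.map C : Matrix (Fin m) (Fin m) (MvPolynomial (Fin n × Fin n) ℂ)) a b)).adjugate i j ∈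
          Ideal.span {perPoly (Fin n) ℂ} :=
  Inlined.not_orbitCorankTwo_constGauge_of_tight htight

/-! ## (e) near-misses / computations (prose only; nothing below is claimed as a theorem)

* One-sided gauge (`Q = 1`) and degree-≤-1 gauges are NOT refuted by the tight witness `T = (1+V)G(1+U)`:
  exact check (folder `py/onesided.py`): `(1-V)·T = G·(1+U)` and `T·(1-U) = (1+V)·G` are affine with
  `det = per₃` and linear part of generic rank 5 (corank 2 ⇒ adj = 0 ⇒ j ≥ 1).
* Double right twists `G(1+U)(1+ĉ′fᵀ)` with a LINEAR kernel vector `ĉ′` of `lin(G(1+U))` (it is unique: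
  `X₂₀e_{u₁} - X₁₀e_{u₂}`) give no new tight representation (all rank 5; exact, `py/twotwist.py`) — no
  `(exc_c, exc_w, j) = (2,0,0)` witness found this way (such a witness would refute the ONE-sided
  strengthening by left-gauge invariance of `d_c`).
* kit j018433 (`jobs/zprobe`, numpy, 72 s; evidence compute-j018433.json): Gauss–Newton continuation on
  `Rep₇(per₃) = {affine 7×7 A : det A = per₃}` (490 coefficients, 900 evaluation equations) from `T`
  along 30 random Zariski-tangent directions.  FINDINGS: (1) `T` has Zariski tangent nullity 135 (so do
  all 30 nearby converged points; by j018723 below this is 126 = dim of the component `Z′ ∋ T` plus 9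
  obstructed directions), while `G` has nullity 141 (`G ∈ Z′` through the affine plane `(1+tV)G(1+sU)`);
  so the component of `T` and `G` IS the generically tight component of EvidenceIdeator3 ('126 + 9').
  (2) all 30 points (sup-distance 0.013–0.06 from `T`, residual ≤ 2e-13) are TIGHT (corank 1 of `L(y)`
  at 8 random `y ∈ V(per₃)`), with degree-1 kernel AND cokernel vectors of `L` over `ℂ[x]`
  (`δ = δ′ = 1`, like `T`).  (3) Hom-lifts: no nonzero module map `coker A → coker G` or `→ coker T`
  lifts to a pair `(P, Q′)` of degree ≤ 1 for these points (excess nullity 0 over the trivial family;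
  for `T → G` it is 1, the untwist), and a 4-dimensional space lifts in degree ≤ 2 (vs `G`, trial 0).
* CORRECTION to the untwist lever (card kernel-syzygy-untwist / NotesIdeator2 L-B says 'corank 2 iff
  eᵀv₀ ≠ 0'): for tight `A = A₀ + L` with `Lĉ = 0` (`ĉ` linear), `e` constant with `eᵀĉ ≡ 0`, the move
  `A(1 + ĉeᵀ)` is affine with `det = per₃`, and its linear part `L + A₀ĉeᵀ` has corank 2 over `ℂ(x)`
  IFF `1 + eᵀv₀ ≡ 0` where `L v₀ = A₀ĉ` (`v₀ ∈ ℂ(x)⁷`, defined mod `ĉ`) — an identity of rational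
  functions, not an open condition: for `T` only `e ∝ e_{u₀}` works on the right and `e ∝ e_{v₀}`
  (essentially) on the left; generic admissible `e` FAILS (exact, `py/untwist_e.py`; this is also why
  j018433's random-`e` test reported rank 6 everywhere, including on `T`).  Two-sided one-step move
  `(1 + e′ŵᵀ)A(1 + ĉeᵀ)` (affine because `ŵᵀA₀ĉ = 0`): corank 2 iff
  `(1 + eᵀv₀)(1 + ŵᵀA₀v₁) - (eᵀv₁)(ŵᵀA₀v₀) ≡ 0` with `L v₁ = e′`.  kit j018629 (`jobs/zprobe2`) tests
  the solvability of these identities; kit j018687/j018703/j018723 (`jobs/zprobe3..5`) extend the sample to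
  directed walks on the component (sup-distance 0.64, Frobenius 2.9 from `T`), recompute `ĉ, ŵ` from the
  exact-coefficient systems, use the minimum-norm solution `e*`, and vary the Gauss–Newton tolerance.
  RESULT (numerical, folder ZPROBE.md, evidence): the component `Z ∋ T, G` has dimension 126 with a
  135-dimensional Zariski tangent space everywhere (9 obstructed directions, singular values ∝ √tol —
  EvidenceIdeator3's '126 + 9'); at EVERY sampled point of `Z`: tight, `δ = δ′ = 1` (defect ∝ √tol → 0),
  `Eᵀv₀(x)` CONSTANT in `x`, and the one-sided degree-1 unipotent gauge `A ↦ A(1 + ĉe*ᵀ)`,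
  `e* = -p̄/|p̄|²` (norm 5–25 away from `T`), is affine with `det = per₃` and takes `σ₆(lin)` from
  O(0.05–0.7) down to the tolerance floor (1e-9) with `σ₇ ≈ 1e-12`: corank 2 at infinity, `j ≥ 1`.
  So the announced refutation locus (generic orbit of the tight component) SATISFIES the crux
  numerically, through `P = 1` and a `Q` of x-degree 1 — no kill there.  For provers: the lever is
  L-B with the corrected solvability condition; 'for a tight representation with `δ = 1`, `Eᵀv₀` is
  constant' is the statement to prove (it gives OrbitCorankTwo at (3,7) on `Z`, size-preserving).
  Untested: other components of `Rep₇(per₃)` (if any beyond `Z` and its j ≥ 1 sub-loci), `n ≥ 4`.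
* What a refutation would still need: an EXACT point of `Z′` off the untwistable locus and an orbit
  invariant — neither is in reach; what a proof on `Z′` would need: a gauge of higher degree or more
  steps whenever the one-step identities are unsolvable at the generic point of `Z′`.
-/

end Summit.ValiantsHypothesis.ValiantsHypothesis.Cruxes.OrbitCorankTwo.Disproof
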